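import Mathlib
import HarnessLib
import Summits.HubbardSuperconductivity.HubbardSuperconductivity.Theorems.KLProgrammeC4aPPKernelOneSidedRows

/-!
# Route `KLProgramme` — crux C4a, S3 brick (B4) «(B4)-UMK1», «(M1)-HFLAT-BOX»: the anti-diagonal flatness row of the ONE-SIDED split kernel on a LEVEL BOX
# `[lo,hi]` with a Lipschitz level weight — `|∫_{lo..hi} wt(e)·(K⁺_e)′(D−e) de| ≤ W·(A₁·Λ/max(D,Λ)² + C₁(1−t₁)⁻²·lo/max(D,lo)²) + W′C₁t₁²(1−t₁)⁻²` for `0 < D ≤ hi/t₁`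

Cell `gate-hubbard-kl`, seat hubbard-kl-k3c3-p1 (g16; row «δμ-flow with klAngularMean constant piece»).  Located brick for the (U1) chain of hubbard-kl-k3c3-p3 (the
`hflat` row of `…C4aPreCausticLevelLineSplit` / `…C4aFoldBoxPreLaw`) / the (C)-closer lane (stub (C) `stub_twoLeg_curvature` of `KLRegimeEngineV17F2`,
stmt-HubbardSuperconductivity-20437); memo HOME/hubbard-kl-k3c3-p1/g16-M1-NEG-PRE-KERNEL.md §6.

WHY (located, bus 01:45Z).  The row as typed — `∀ D > 0, |∫_{lo..hi} wt·(Kr e)′(D−e)| ≤ Afl·lo/max(D,lo)²` — cannot hold with `n`-free `Afl` for `D > hi/t₁`: integrating by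
parts along the anti-diagonal on the BOX leaves the boundary term `(1/D)·wt(hi)·N(hi,D−hi)·(hi/D)·κ(hi/D) ≍ W·hi/D²` once `κ(hi/D) ≠ 0`; and a weight that varies on
`[lo, t₁D]` costs an additive constant.  What IS true, from LANDED pieces only: for `0 < D ≤ hi/t₁` the one-sided kernel's line derivative `(K⁺_e)′(D−e)` VANISHES for
`e ≥ t₁D` (one-sided support), equals g15's flatness integrand `G(e) = ∂ᵤN(e,D−e)κ(e/D)/D − N(e,D−e)(κ′(e/D)(e/D)+κ(e/D))/D²` for `e > 0`, so
`∫_{lo..hi} wt·G = wt(lo)·(∫_0^D G − ∫_0^{lo} G) + ∫_{lo..hi}(wt − wt(lo))·G`: the first bracket is g15's `trueKernel_antidiagonal_flatness_shape` (`A₁Λ/max(D,Λ)²`) minus a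
strip piece bounded by the `hK1` envelope (`|G| ≤ C₁/((1−t₁)D)²` on the support, length `lo`), the last term by the Lipschitz variation `W′(e−lo) ≤ W′t₁D` against the same
envelope on `[lo, t₁D]`.
* §1 `ppOneSidedKernelD1_antidiag_eq` (the identification with `G`), `ppOneSidedKernelD1_antidiag_eq_zero` (`e ≥ t₁D`), `abs_ppOneSidedKernelD1_antidiag_le`
  (`|G(e)| ≤ C₁/((1−t₁)D)²`), `continuous_antidiagIntegrand`;
* §2 **`abs_intervalIntegral_box_flatness_le`** (HEADLINE, the three-term bound) and the `lo = Λ` corollary **`abs_intervalIntegral_box_flatness_le'`**: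
  `≤ Afl·(Λ/max(D,Λ)²) + Bfl`, `Afl = W(A₁ + C₁/(1−t₁)²)`, `Bfl = W′C₁t₁²/(1−t₁)²`, `A₁ = (6B₁+5/2)(2κ₀+κ₁)·4/(1−t₁)² + κ₀(10B₁+7/2+2/(βΛ)+1/(1−t₁))`,
  `C₁ = κ₀(6B₁+5/2)/(1−t₁)+κ₀+κ₁`.
Pure real analysis on Literature objects; nothing asserts (C), K3, the window or superconductivity.
References: FST II CPAM 51 (1998) §3 [cite: FeldmanSalmhoferTrubowitz1998]; BGM 2006 §2.4 (2.36) [cite: BenfattoGiulianiMastropietro2006]; Salmhofer 1999 §4.5.3 [cite: Salmhofer1999].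
-/

noncomputable section

namespace Summit.HubbardSuperconductivity.HubbardSuperconductivity.Theorems.C4a

set_option linter.dupNamespace false -- summit = problem name (single-conjunct summit), D-0017

open Real Filter Set MeasureTheory intervalIntegral
open scoped Topology Interval
open Literature.MathematicalPhysics.QuantumLattice Literature.Analysis.SpecialFunctions

section Flat

variable {β Λ : ℝ} (hβ : 0 < β) (hΛ : 0 < Λ) {B₁ : ℝ} (hB₁ : ∀ x, |deriv salmhoferCutoff x| ≤ B₁)
  {κ κ' : ℝ → ℝ} (hκ : ∀ t, HasDerivAt κ (κ' t) t) (hκ'c : Continuous κ') {κ₀ κ₁ : ℝ} (hκb : ∀ t ∈ Icc 0 1, |κ t| ≤ κ₀) (hκ'b : ∀ t ∈ Icc 0 1, |κ' t| ≤ κ₁)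
  {t₁ : ℝ} (ht₀ : 0 < t₁) (ht₁ : t₁ < 1) (hκs : ∀ t, t₁ ≤ t → κ t = 0) (hκ's : ∀ t, t₁ ≤ t → κ' t = 0)

/-! ## §1 The line derivative of `K⁺` along the anti-diagonal is g15's flatness integrand, and vanishes beyond `t₁D` -/

include ht₁ hκs hκ's in
/-- **Identification**: for `e > 0`, `D > 0`: `K⁺′(e, D−e) = ∂ᵤN(e,D−e)·κ(e/D)/D − N(e,D−e)·(κ′(e/D)(e/D) + κ(e/D))/D²` (on `e ≥ D` both sides vanish).
[cite: BenfattoGiulianiMastropietro2006, §2.4 (2.36)] -/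
theorem ppOneSidedKernelD1_antidiag_eq {e D : ℝ} (hD : 0 < D) :
    ppOneSidedKernelD1 β Λ κ κ' e (D - e) =
      ppTrueNumeratorDu β Λ e (D - e) * κ (e / D) / D - ppTrueNumerator β Λ e (D - e) * (κ' (e / D) * (e / D) + κ (e / D)) / D ^ 2 := by
  unfold ppOneSidedKernelD1
  by_cases h0 : 0 < D - e
  · rw [if_pos h0, show e + (D - e) = D by ring]
    field_simp
    ring
  · rw [if_neg h0]
    have hge : t₁ ≤ e / D := by
      rw [le_div_iff₀ hD]; nlinarith
    rw [hκs _ hge, hκ's _ hge]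
    simp

include ht₀ hκs hκ's in
/-- **Vanishing beyond `t₁D`**: `e > 0`, `t₁D ≤ e` ⟹ `K⁺′(e, D−e) = 0`. [folklore] -/
theorem ppOneSidedKernelD1_antidiag_eq_zero {e D : ℝ} (he : 0 < e) (heD : t₁ * D ≤ e) : ppOneSidedKernelD1 β Λ κ κ' e (D - e) = 0 := by
  refine ppOneSidedKernelD1_eq_zero_of_le ht₀ hκs hκ's he ?_
  rw [le_div_iff₀ ht₀]
  nlinarith

include hβ hΛ hB₁ ht₀ ht₁ hκs hκ's hκb hκ'b in
/-- **The envelope along the anti-diagonal**: `e > 0`, `D > 0` ⟹ `|K⁺′(e, D−e)| ≤ C₁/((1−t₁)D)²`, `C₁ = κ₀(6B₁+5/2)/(1−t₁)+κ₀+κ₁`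
(zero beyond `t₁D`; before it the partner level is `≥ (1−t₁)D`). [cite: BenfattoGiulianiMastropietro2006, §2.4 (2.36)] -/
theorem abs_ppOneSidedKernelD1_antidiag_le {e D : ℝ} (he : 0 < e) (hD : 0 < D) :
    |ppOneSidedKernelD1 β Λ κ κ' e (D - e)| ≤ (κ₀ * ((6 * B₁ + 5 / 2) / (1 - t₁)) + κ₀ + κ₁) / ((1 - t₁) * D) ^ 2 := by
  have hB0 := salmhoferB₁_nonneg hB₁
  have h1t : 0 < 1 - t₁ := by linarith
  have hκ₀ : 0 ≤ κ₀ := (abs_nonneg _).trans (hκb 0 (left_mem_Icc.2 zero_le_one))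
  have hκ₁ : 0 ≤ κ₁ := (abs_nonneg _).trans (hκ'b 0 (left_mem_Icc.2 zero_le_one))
  have hC : 0 ≤ κ₀ * ((6 * B₁ + 5 / 2) / (1 - t₁)) + κ₀ + κ₁ := by positivity
  rcases le_or_gt (t₁ * D) e with hfar | hnear
  · rw [ppOneSidedKernelD1_antidiag_eq_zero ht₀ hκs hκ's he hfar, abs_zero]; positivity
  · have h := abs_ppOneSidedKernelD1_le hβ hΛ hB₁ ht₀ ht₁ hκs hκ's he hκb hκ'b (D - e)
    -- `(max e |D−e|)⁻¹² ≤ ((1−t₁)D)⁻¹²`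
    have hle : (1 - t₁) * D ≤ max e |D - e| := by
      refine le_max_of_le_right ?_
      rw [abs_of_pos (by nlinarith)]; nlinarith
    have h0 : 0 < (1 - t₁) * D := by positivity
    have hinv : (max e |D - e|)⁻¹ ^ 2 ≤ 1 / ((1 - t₁) * D) ^ 2 := by
      rw [inv_pow, ← one_div]
      exact one_div_le_one_div_of_le (by positivity) (pow_le_pow_left₀ h0.le hle 2)
    calc |ppOneSidedKernelD1 β Λ κ κ' e (D - e)| ≤ (κ₀ * ((6 * B₁ + 5 / 2) / (1 - t₁)) + κ₀ + κ₁) * (max e |D - e|)⁻¹ ^ 2 := h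
      _ ≤ (κ₀ * ((6 * B₁ + 5 / 2) / (1 - t₁)) + κ₀ + κ₁) * (1 / ((1 - t₁) * D) ^ 2) := mul_le_mul_of_nonneg_left hinv hC
      _ = (κ₀ * ((6 * B₁ + 5 / 2) / (1 - t₁)) + κ₀ + κ₁) / ((1 - t₁) * D) ^ 2 := by ring

include hβ hΛ hB₁ hκ hκ'c in
/-- g15's flatness integrand `G(e)` is continuous in `e` (`D` fixed). [cite: BenfattoGiulianiMastropietro2006, §2.4 (2.36)] -/
theorem continuous_antidiagIntegrand (D : ℝ) : Continuous fun e : ℝ =>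
    ppTrueNumeratorDu β Λ e (D - e) * κ (e / D) / D - ppTrueNumerator β Λ e (D - e) * (κ' (e / D) * (e / D) + κ (e / D)) / D ^ 2 := by
  have hκc : Continuous κ := continuous_iff_continuousAt.2 fun t => (hκ t).continuousAt
  have hκD : Continuous fun e : ℝ => κ (e / D) := hκc.comp (continuous_id.div_const D)
  have hκ'D : Continuous fun e : ℝ => κ' (e / D) := hκ'c.comp (continuous_id.div_const D)
  have hN : Continuous fun e : ℝ => ppTrueNumerator β Λ e (D - e) := continuous_ppTrueNumerator_comp hβ Λ continuous_id (continuous_const.sub continuous_id)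
  have hN' : Continuous fun e : ℝ => ppTrueNumeratorDu β Λ e (D - e) := continuous_ppTrueNumeratorDu_line hβ hΛ hB₁ D
  exact ((hN'.mul hκD).div_const D).sub ((hN.mul ((hκ'D.mul (continuous_id.div_const D)).add hκD)).div_const _)

/-! ## §2 The box flatness -/

include hβ hΛ hB₁ hκ hκ'c hκb hκ'b ht₀ ht₁ hκs hκ's in
/-- **THE ANTI-DIAGONAL FLATNESS OF `K⁺` ON A LEVEL BOX WITH A LIPSCHITZ WEIGHT** (HEADLINE).  `0 < β`, `0 < Λ`, `|χ′| ≤ B₁`; split profile `κ ∈ C¹`, `|κ| ≤ κ₀`,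
`|κ′| ≤ κ₁` on `[0,1]`, `κ = κ′ = 0` on `[t₁,∞)`, `0 < t₁ < 1`; levels `0 < lo ≤ hi`; weight `wt` continuous on `[lo,hi]` with `|wt| ≤ W` and `|wt e − wt lo| ≤ W′(e − lo)`;
`0 < D ≤ hi/t₁`.  THEN
`|∫_{lo..hi} wt(e)·deriv(K⁺(e,·))(D−e) de| ≤ W·(A₁·Λ/max(D,Λ)² + C₁/(1−t₁)²·lo/max(D,lo)²) + W′·C₁·t₁²/(1−t₁)²`
with `A₁ = (6B₁+5/2)(2κ₀+κ₁)·4/(1−t₁)² + κ₀(10B₁+7/2+2/(βΛ)+1/(1−t₁))` (g15 `trueKernel_antidiagonal_flatness_shape`) and `C₁ = κ₀(6B₁+5/2)/(1−t₁)+κ₀+κ₁`.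
[cite: FeldmanSalmhoferTrubowitz1998, §3] -/
theorem abs_intervalIntegral_box_flatness_le {lo hi : ℝ} (hlo : 0 < lo) (hlohi : lo ≤ hi) {wt : ℝ → ℝ} {W W' : ℝ} (hwc : ContinuousOn wt (Icc lo hi))
    (hwW : ∀ e ∈ Icc lo hi, |wt e| ≤ W) (hW' : 0 ≤ W') (hwL : ∀ e ∈ Icc lo hi, |wt e - wt lo| ≤ W' * (e - lo)) {D : ℝ} (hD : 0 < D)
    (hDhi : D ≤ hi / t₁) :
    |∫ e in lo..hi, wt e * deriv (fun v : ℝ => ppOneSidedKernel β Λ κ e v) (D - e)| ≤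
      W * (((6 * B₁ + 5 / 2) * (2 * κ₀ + κ₁) * (4 / (1 - t₁) ^ 2) + κ₀ * (10 * B₁ + 7 / 2 + 2 / (β * Λ) + 1 / (1 - t₁))) * (Λ / max D Λ ^ 2) +
          (κ₀ * ((6 * B₁ + 5 / 2) / (1 - t₁)) + κ₀ + κ₁) / (1 - t₁) ^ 2 * (lo / max D lo ^ 2)) +
        W' * (κ₀ * ((6 * B₁ + 5 / 2) / (1 - t₁)) + κ₀ + κ₁) * t₁ ^ 2 / (1 - t₁) ^ 2 := by
  have hB0 := salmhoferB₁_nonneg hB₁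
  have h1t : 0 < 1 - t₁ := by linarith
  have hκ₀ : 0 ≤ κ₀ := (abs_nonneg _).trans (hκb 0 (left_mem_Icc.2 zero_le_one))
  have hκ₁ : 0 ≤ κ₁ := (abs_nonneg _).trans (hκ'b 0 (left_mem_Icc.2 zero_le_one))
  have hloI : lo ∈ Icc lo hi := left_mem_Icc.2 hlohi
  have hW0 : 0 ≤ W := (abs_nonneg _).trans (hwW lo hloI)
  set C₁ : ℝ := κ₀ * ((6 * B₁ + 5 / 2) / (1 - t₁)) + κ₀ + κ₁ with hC₁
  set A₁ : ℝ := (6 * B₁ + 5 / 2) * (2 * κ₀ + κ₁) * (4 / (1 - t₁) ^ 2) + κ₀ * (10 * B₁ + 7 / 2 + 2 / (β * Λ) + 1 / (1 - t₁)) with hA₁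
  have hC₁0 : 0 ≤ C₁ := by positivity
  have hA₁0 : 0 ≤ A₁ := by positivity
  have hmaxΛ : 0 < max D Λ := lt_max_of_lt_left hD
  have hmaxlo : 0 < max D lo := lt_max_of_lt_left hD
  have hRHS0 : 0 ≤ W * (A₁ * (Λ / max D Λ ^ 2) + C₁ / (1 - t₁) ^ 2 * (lo / max D lo ^ 2)) + W' * C₁ * t₁ ^ 2 / (1 - t₁) ^ 2 := by positivity
  -- the flatness integrand
  obtain ⟨G, hGdef⟩ : ∃ G : ℝ → ℝ, G = fun e => ppTrueNumeratorDu β Λ e (D - e) * κ (e / D) / D -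
      ppTrueNumerator β Λ e (D - e) * (κ' (e / D) * (e / D) + κ (e / D)) / D ^ 2 := ⟨_, rfl⟩
  have hGc : Continuous G := by rw [hGdef]; exact continuous_antidiagIntegrand hβ hΛ hB₁ hκ hκ'c D
  have hGi : ∀ a b : ℝ, IntervalIntegrable G volume a b := fun a b => hGc.intervalIntegrable a b
  have hGD1 : ∀ e, G e = ppOneSidedKernelD1 β Λ κ κ' e (D - e) := fun e => by
    rw [hGdef, ppOneSidedKernelD1_antidiag_eq ht₁ hκs hκ's hD]
  have hGzero : ∀ e, 0 < e → t₁ * D ≤ e → G e = 0 := fun e he heD => by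
    rw [hGD1]; exact ppOneSidedKernelD1_antidiag_eq_zero ht₀ hκs hκ's he heD
  have hGenv : ∀ e, 0 < e → |G e| ≤ C₁ / ((1 - t₁) * D) ^ 2 := fun e he => by
    rw [hGD1]; exact abs_ppOneSidedKernelD1_antidiag_le hβ hΛ hB₁ hκb hκ'b ht₀ ht₁ hκs hκ's he hD
  have ht₁D : t₁ * D ≤ hi := by rw [le_div_iff₀ ht₀] at hDhi; linarith
  -- `deriv K⁺(e,·)(D−e) = G e` on the box
  have hderiv : ∀ e ∈ uIcc lo hi, wt e * deriv (fun v : ℝ => ppOneSidedKernel β Λ κ e v) (D - e) = wt e * G e := fun e he => by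
    rw [uIcc_of_le hlohi] at he
    have he0 : 0 < e := hlo.trans_le he.1
    rw [deriv_ppOneSidedKernel hβ hΛ hB₁ hκ ht₀ ht₁ hκs he0, hGD1]
  rw [intervalIntegral.integral_congr hderiv]
  -- integrability of the weighted integrand on sub-boxes of `[lo,hi]`
  have hwGi : ∀ a b : ℝ, a ∈ Icc lo hi → b ∈ Icc lo hi → IntervalIntegrable (fun e => wt e * G e) volume a b := fun a b ha hb =>
    ((hwc.mono (uIcc_subset_Icc ha hb)).mul hGc.continuousOn).intervalIntegrable
  rcases le_or_gt (t₁ * D) lo with hcase | hcase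
  · -- the whole box lies beyond `t₁D`: the integrand vanishes
    have h0 : ∫ e in lo..hi, wt e * G e = 0 := by
      rw [← intervalIntegral.integral_zero (a := lo) (b := hi) (μ := volume)]
      refine intervalIntegral.integral_congr fun e he => ?_
      rw [uIcc_of_le hlohi] at he
      rw [hGzero e (hlo.trans_le he.1) (hcase.trans he.1), mul_zero]
    rw [h0, abs_zero]
    exact hRHS0
  · -- `lo < t₁D`: then `lo < D` and `max D lo = D`
    have htD : t₁ * D < D := by nlinarith [mul_pos h1t hD]
    have hDlo : lo < D := hcase.trans htD
    have hmax : max D lo = D := max_eq_left hDlo.le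
    -- split the weight at its value at `lo`
    have hsum : (fun e => wt e * G e) = fun e => wt lo * G e + (wt e - wt lo) * G e := funext fun e => by ring
    have hhiI : hi ∈ Icc lo hi := right_mem_Icc.2 hlohi
    have htDI : t₁ * D ∈ Icc lo hi := ⟨hcase.le, ht₁D⟩
    have hvari : ∀ a b : ℝ, a ∈ Icc lo hi → b ∈ Icc lo hi → IntervalIntegrable (fun e => (wt e - wt lo) * G e) volume a b := fun a b ha hb => by
      have h := (hwGi a b ha hb).sub ((hGi a b).const_mul (wt lo))
      exact h.congr fun e _ => by ring
    rw [hsum, intervalIntegral.integral_add ((hGi lo hi).const_mul (wt lo)) (hvari lo hi hloI hhiI), intervalIntegral.integral_const_mul]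
    -- (I) the constant part: `∫_{lo}^{hi} G = ∫_0^D G − ∫_0^{lo} G`
    have hI : ∫ e in lo..hi, G e = (∫ e in (0 : ℝ)..D, G e) - ∫ e in (0 : ℝ)..lo, G e := by
      have h1 : ∫ e in D..hi, G e = 0 := by
        rw [← intervalIntegral.integral_zero (a := D) (b := hi) (μ := volume)]
        refine intervalIntegral.integral_congr fun e he => ?_
        have hmin : min D hi ≤ e := by
          rcases le_total D hi with h | h
          · rw [uIcc_of_le h] at he; rw [min_eq_left h]; exact he.1
          · rw [uIcc_of_ge h] at he; rw [min_eq_right h]; exact he.1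
        have heD : t₁ * D ≤ e := le_trans (le_min (by nlinarith) ht₁D) hmin
        have he0 : 0 < e := lt_of_lt_of_le (by positivity : 0 < t₁ * D) heD
        exact hGzero e he0 heD
      have h2 := intervalIntegral.integral_add_adjacent_intervals (hGi lo D) (hGi D hi)
      have h3 := intervalIntegral.integral_add_adjacent_intervals (hGi 0 lo) (hGi lo D)
      linarith
    have hfull : |∫ e in (0 : ℝ)..D, G e| ≤ A₁ * (Λ / max D Λ ^ 2) := by
      rw [hGdef, hA₁]; exact trueKernel_antidiagonal_flatness_shape hβ hΛ hB₁ hκ hκ'c hκb hκ'b ht₀.le ht₁ hκs hD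
    have hstrip : |∫ e in (0 : ℝ)..lo, G e| ≤ C₁ / ((1 - t₁) * D) ^ 2 * lo := by
      have h := intervalIntegral.norm_integral_le_of_norm_le_const (a := (0 : ℝ)) (b := lo) (f := G) (C := C₁ / ((1 - t₁) * D) ^ 2) fun e he => by
        rw [uIoc_of_le hlo.le] at he
        rw [Real.norm_eq_abs]; exact hGenv e he.1
      rw [Real.norm_eq_abs, sub_zero, abs_of_pos hlo] at h
      exact h
    have hconst : |wt lo * ∫ e in lo..hi, G e| ≤ W * (A₁ * (Λ / max D Λ ^ 2) + C₁ / (1 - t₁) ^ 2 * (lo / max D lo ^ 2)) := by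
      rw [abs_mul, hI]
      have h1 : |(∫ e in (0 : ℝ)..D, G e) - ∫ e in (0 : ℝ)..lo, G e| ≤ A₁ * (Λ / max D Λ ^ 2) + C₁ / (1 - t₁) ^ 2 * (lo / max D lo ^ 2) := by
        refine (abs_sub _ _).trans (add_le_add hfull (hstrip.trans (le_of_eq ?_)))
        rw [hmax]; field_simp
      exact mul_le_mul (hwW lo hloI) h1 (abs_nonneg _) hW0
    -- (II) the variation part lives on `[lo, t₁D]`
    have hII : |∫ e in lo..hi, (wt e - wt lo) * G e| ≤ W' * C₁ * t₁ ^ 2 / (1 - t₁) ^ 2 := by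
      have h1 : ∫ e in (t₁ * D)..hi, (wt e - wt lo) * G e = 0 := by
        rw [← intervalIntegral.integral_zero (a := t₁ * D) (b := hi) (μ := volume)]
        refine intervalIntegral.integral_congr fun e he => ?_
        rw [uIcc_of_le ht₁D] at he
        have he0 : 0 < e := lt_of_lt_of_le (by positivity : 0 < t₁ * D) he.1
        rw [hGzero e he0 he.1, mul_zero]
      have hsplit2 := intervalIntegral.integral_add_adjacent_intervals (hvari lo (t₁ * D) hloI htDI) (hvari (t₁ * D) hi htDI hhiI)
      rw [← hsplit2, h1, add_zero]
      obtain ⟨M, hM⟩ : ∃ M : ℝ, M = W' * (t₁ * D) * (C₁ / ((1 - t₁) * D) ^ 2) := ⟨_, rfl⟩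
      have hM0 : 0 ≤ M := by rw [hM]; positivity
      have hbound : ∀ e ∈ Ι lo (t₁ * D), ‖(wt e - wt lo) * G e‖ ≤ M := by
        intro e he
        rw [uIoc_of_le hcase.le] at he
        have heI : e ∈ Icc lo hi := ⟨he.1.le, he.2.trans ht₁D⟩
        have he0 : 0 < e := hlo.trans he.1
        have hw1 : |wt e - wt lo| ≤ W' * (t₁ * D) := by
          refine (hwL e heI).trans ?_
          exact mul_le_mul_of_nonneg_left (by linarith [he.2]) hW'
        have hprod : |wt e - wt lo| * |G e| ≤ W' * (t₁ * D) * (C₁ / ((1 - t₁) * D) ^ 2) :=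
          mul_le_mul hw1 (hGenv e he0) (abs_nonneg _) (by positivity)
        rw [Real.norm_eq_abs, abs_mul, hM]
        exact hprod
      have h2 := intervalIntegral.norm_integral_le_of_norm_le_const hbound
      rw [Real.norm_eq_abs, abs_of_pos (by linarith : 0 < t₁ * D - lo)] at h2
      calc |∫ e in lo..t₁ * D, (wt e - wt lo) * G e| ≤ M * (t₁ * D - lo) := h2
        _ ≤ M * (t₁ * D) := mul_le_mul_of_nonneg_left (by linarith) hM0
        _ = W' * C₁ * t₁ ^ 2 / (1 - t₁) ^ 2 := by rw [hM]; field_simp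
    calc |wt lo * (∫ e in lo..hi, G e) + ∫ e in lo..hi, (wt e - wt lo) * G e|
        ≤ |wt lo * ∫ e in lo..hi, G e| + |∫ e in lo..hi, (wt e - wt lo) * G e| := abs_add_le _ _
      _ ≤ W * (A₁ * (Λ / max D Λ ^ 2) + C₁ / (1 - t₁) ^ 2 * (lo / max D lo ^ 2)) + W' * C₁ * t₁ ^ 2 / (1 - t₁) ^ 2 := add_le_add hconst hII

include hβ hΛ hB₁ hκ hκ'c hκb hκ'b ht₀ ht₁ hκs hκ's in
/-- **The `lo = Λ` corollary in the `hflat` currency**: `0 < Λ ≤ hi`, `0 < D ≤ hi/t₁` ⟹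
`|∫_{Λ..hi} wt·deriv(K⁺(e,·))(D−e) de| ≤ Afl·(Λ/max(D,Λ)²) + Bfl`, `Afl = W·(A₁ + C₁/(1−t₁)²)`, `Bfl = W′C₁t₁²/(1−t₁)²`. [cite: FeldmanSalmhoferTrubowitz1998, §3] -/
theorem abs_intervalIntegral_box_flatness_le' {hi : ℝ} (hΛhi : Λ ≤ hi) {wt : ℝ → ℝ} {W W' : ℝ} (hwc : ContinuousOn wt (Icc Λ hi))
    (hwW : ∀ e ∈ Icc Λ hi, |wt e| ≤ W) (hW' : 0 ≤ W') (hwL : ∀ e ∈ Icc Λ hi, |wt e - wt Λ| ≤ W' * (e - Λ)) {D : ℝ} (hD : 0 < D)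
    (hDhi : D ≤ hi / t₁) :
    |∫ e in Λ..hi, wt e * deriv (fun v : ℝ => ppOneSidedKernel β Λ κ e v) (D - e)| ≤
      W * (((6 * B₁ + 5 / 2) * (2 * κ₀ + κ₁) * (4 / (1 - t₁) ^ 2) + κ₀ * (10 * B₁ + 7 / 2 + 2 / (β * Λ) + 1 / (1 - t₁))) +
          (κ₀ * ((6 * B₁ + 5 / 2) / (1 - t₁)) + κ₀ + κ₁) / (1 - t₁) ^ 2) * (Λ / max D Λ ^ 2) +
        W' * (κ₀ * ((6 * B₁ + 5 / 2) / (1 - t₁)) + κ₀ + κ₁) * t₁ ^ 2 / (1 - t₁) ^ 2 := by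
  have h := abs_intervalIntegral_box_flatness_le hβ hΛ hB₁ hκ hκ'c hκb hκ'b ht₀ ht₁ hκs hκ's hΛ hΛhi hwc hwW hW' hwL hD hDhi
  refine h.trans (le_of_eq ?_)
  ring

end Flat

end Summit.HubbardSuperconductivity.HubbardSuperconductivity.Theorems.C4a

end
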